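import Summits.CriticalPhenomena.Ising3DConformalLimit.Theorems.EnergyNotSigmaSquaredMoebiusLimitExistsOneMapOneJetDefs
import Mathlib.Algebra.Polynomial.Roots
import HarnessLib

/-!
# Density of the doubly-good punctured configurations
(line `one-map-one-jet` for the crux `MoebiusLimitExists`, item stmt-CriticalPhenomena-1344;
stub `stub_invGoodConfig_dense` of the checked skeleton `Cruxes/MoebiusLimitExists/Lines/one-map-one-jet.lean`)

`PuncturedNonCoincident n ⊆ closure (InvGoodConfig n)`: every non-coincident configuration of `n`
points of `ℝ³` avoiding the pole `0` of the unit inversion `ι` is a limit of DOUBLY-GOOD punctured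
configurations (both `x` and `ι x` are separated by the three coordinate projections).

Proof. Perturb `x` along the ray configuration: `x(ε) i = x i + ε • ((i + 1) • p₀)` with
`p₀ = rayBase = e₀ + 2e₁ + 4e₂`. As `ε → 0⁺`, `x(ε) → x`, and for all sufficiently small `ε > 0`
the configuration `x(ε)` is doubly good for the COORDINATE frame `a ↦ e_a`:
* `x(ε) i ≠ 0` by continuity (`x i ≠ 0`);
* the `a`-th coordinates of `x(ε) i` and `x(ε) j` (`i ≠ j`) differ: their difference is affine in
  `ε` with slope `(i − j) (p₀)_a ≠ 0`;
* the `a`-th coordinates of `ι (x(ε) i)` and `ι (x(ε) j)` differ: after clearing the denominators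
  `‖x(ε) i‖² ‖x(ε) j‖²` their difference is a real cubic in `ε` with `ε³`-coefficient
  `(i+1)(j+1)(j−i) (p₀)_a ‖p₀‖² ≠ 0`, and a non-zero real polynomial has no roots in `(0, δ)` for
  some `δ > 0` (finitely many roots).
Finitely many indices `(a, i, j)`, so all conditions hold simultaneously for small `ε > 0`.
-/

open Set Function Filter EuclideanGeometry
open scoped Topology
open Literature.Probability.LatticeModels

namespace Summit.CriticalPhenomena.Ising3DConformalLimit.MoebiusLimitExistsOneMapOneJet

namespace InvGoodConfigDensity

/-! ### One-dimensional facts: a non-zero real polynomial has no small positive roots -/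

open Polynomial in
/-- A non-zero real polynomial does not vanish at any sufficiently small `ε > 0` (it has finitely
many roots). [folklore] -/
theorem eventually_eval_ne_zero {P : ℝ[X]} (hP : P ≠ 0) :
    ∀ᶠ ε in 𝓝[>] (0 : ℝ), P.eval ε ≠ 0 := by
  have hfin : {y : ℝ | P.IsRoot y}.Finite := Polynomial.finite_setOf_isRoot hP
  have h : ∀ᶠ ε in 𝓝[>] (0 : ℝ), ∀ y ∈ {y : ℝ | P.IsRoot y}, ε ≠ y := by
    refine hfin.eventually_all.2 fun y _ => ?_
    rcases eq_or_ne y 0 with rfl | hy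
    · exact eventually_nhdsWithin_of_forall fun ε hε => (Set.mem_Ioi.1 hε).ne'
    · exact eventually_nhdsWithin_of_eventually_nhds (eventually_ne_nhds hy.symm)
  exact h.mono fun ε hε hzero => hε ε hzero rfl

open Polynomial in
/-- An affine function `c + d ε` with `d ≠ 0` is non-zero for all sufficiently small `ε > 0`.
[folklore] -/
theorem eventually_affine_ne_zero (c d : ℝ) (hd : d ≠ 0) :
    ∀ᶠ ε in 𝓝[>] (0 : ℝ), c + d * ε ≠ 0 := by
  have hP : (C c + C d * X : ℝ[X]) ≠ 0 := by
    intro h0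
    have h1 : (C c + C d * X : ℝ[X]).coeff 1 = d := by simp
    rw [h0, coeff_zero] at h1
    exact hd h1.symm
  refine (eventually_eval_ne_zero hP).mono fun ε hε => ?_
  simpa using hε

open Polynomial in
/-- A real cubic `c₀ + c₁ ε + c₂ ε² + c₃ ε³` with `c₃ ≠ 0` is non-zero for all sufficiently small
`ε > 0`. [folklore] -/
theorem eventually_cubic_ne_zero (c₀ c₁ c₂ c₃ : ℝ) (h₃ : c₃ ≠ 0) :
    ∀ᶠ ε in 𝓝[>] (0 : ℝ), c₀ + c₁ * ε + c₂ * ε ^ 2 + c₃ * ε ^ 3 ≠ 0 := by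
  have hP : (C c₀ + C c₁ * X + C c₂ * X ^ 2 + C c₃ * X ^ 3 : ℝ[X]) ≠ 0 := by
    intro h0
    have h3 : (C c₀ + C c₁ * X + C c₂ * X ^ 2 + C c₃ * X ^ 3 : ℝ[X]).coeff 3 = c₃ := by
      simp
    rw [h0, coeff_zero] at h3
    exact h₃ h3.symm
  refine (eventually_eval_ne_zero hP).mono fun ε hε => ?_
  simpa using hε

/-! ### Pairs of points moving along fixed directions -/

/-- Coordinates of two points moving affinely along directions with distinct `a`-th coordinates
are distinct for all sufficiently small times `ε > 0`. [folklore] -/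
theorem eventually_apply_ne {p q u v : EuclideanSpace ℝ (Fin 3)} {a : Fin 3} (h : u a ≠ v a) :
    ∀ᶠ ε in 𝓝[>] (0 : ℝ), (p + ε • u) a ≠ (q + ε • v) a := by
  refine (eventually_affine_ne_zero (p a - q a) (u a - v a) (sub_ne_zero.2 h)).mono
    fun ε hε heq => hε ?_
  simp only [PiLp.add_apply, PiLp.smul_apply, smul_eq_mul] at heq
  linear_combination heq

/-- `‖p + ε • u‖² = ‖p‖² + 2 ε ⟪p, u⟫ + ε² ‖u‖²`. [folklore] -/
theorem norm_add_smul_sq (p u : EuclideanSpace ℝ (Fin 3)) (ε : ℝ) :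
    ‖p + ε • u‖ ^ 2 = ‖p‖ ^ 2 + 2 * (ε * inner ℝ p u) + ε ^ 2 * ‖u‖ ^ 2 := by
  rw [norm_add_sq_real, real_inner_smul_right, norm_smul, mul_pow, Real.norm_eq_abs, sq_abs]

/-- The cleared-denominator numerator of the `a`-th coordinate of `ι (p + ε u) − ι (q + ε v)`,
`(p + ε u)_a ‖q + ε v‖² − (q + ε v)_a ‖p + ε u‖²`, is a cubic in `ε` with `ε³`-coefficient
`u_a ‖v‖² − v_a ‖u‖²`; if that coefficient is non-zero, the numerator is non-zero for all
sufficiently small `ε > 0`. [folklore] -/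
theorem eventually_invNumerator_ne_zero {p q u v : EuclideanSpace ℝ (Fin 3)} {a : Fin 3}
    (h : u a * ‖v‖ ^ 2 - v a * ‖u‖ ^ 2 ≠ 0) :
    ∀ᶠ ε in 𝓝[>] (0 : ℝ),
      (p + ε • u) a * ‖q + ε • v‖ ^ 2 - (q + ε • v) a * ‖p + ε • u‖ ^ 2 ≠ 0 := by
  refine (eventually_cubic_ne_zero (p a * ‖q‖ ^ 2 - q a * ‖p‖ ^ 2)
    (u a * ‖q‖ ^ 2 + 2 * (p a * inner ℝ q v) - v a * ‖p‖ ^ 2 - 2 * (q a * inner ℝ p u))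
    (2 * (u a * inner ℝ q v) + p a * ‖v‖ ^ 2 - 2 * (v a * inner ℝ p u) - q a * ‖u‖ ^ 2)
    (u a * ‖v‖ ^ 2 - v a * ‖u‖ ^ 2) h).mono fun ε hε heq => hε ?_
  rw [norm_add_smul_sq, norm_add_smul_sq, PiLp.add_apply, PiLp.add_apply, PiLp.smul_apply,
    PiLp.smul_apply, smul_eq_mul, smul_eq_mul] at heq
  linear_combination heq

/-- If the cleared-denominator numerator is non-zero (and both points avoid the pole), the `a`-th
coordinates of the unit inversions `ι p = ‖p‖⁻² p` and `ι q` differ. [folklore] -/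
theorem inversion_apply_ne {p q : EuclideanSpace ℝ (Fin 3)} (hp : p ≠ 0) (hq : q ≠ 0) {a : Fin 3}
    (h : p a * ‖q‖ ^ 2 - q a * ‖p‖ ^ 2 ≠ 0) :
    (inversion (0 : EuclideanSpace ℝ (Fin 3)) 1 p) a ≠
      (inversion (0 : EuclideanSpace ℝ (Fin 3)) 1 q) a := by
  rw [inversion_zero_one_eq_smul, inversion_zero_one_eq_smul, PiLp.smul_apply, PiLp.smul_apply,
    smul_eq_mul, smul_eq_mul]
  intro heq
  apply h
  have hp2 : ‖p‖ ^ 2 ≠ 0 := pow_ne_zero 2 (norm_ne_zero_iff.2 hp)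
  have hq2 : ‖q‖ ^ 2 ≠ 0 := pow_ne_zero 2 (norm_ne_zero_iff.2 hq)
  rw [inv_mul_eq_div, inv_mul_eq_div, div_eq_div_iff hp2 hq2] at heq
  linear_combination heq

/-! ### The ray directions `(i + 1) • p₀` -/

/-- Distinct multiples of `p₀` have distinct `a`-th coordinates. [folklore] -/
theorem smul_rayBase_apply_ne {α β : ℝ} (hαβ : α ≠ β) (a : Fin 3) :
    (α • rayBase) a ≠ (β • rayBase) a := by
  simp only [PiLp.smul_apply, smul_eq_mul]
  exact fun h => hαβ (mul_right_cancel₀ (rayBase_apply_ne_zero a) h)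

/-- The `ε³`-coefficient `u_a ‖v‖² − v_a ‖u‖² = α β (β − α) (p₀)_a ‖p₀‖²` for the ray directions
`u = α p₀`, `v = β p₀` is non-zero when `α, β` are non-zero and distinct. [folklore] -/
theorem smul_rayBase_coeff_ne_zero {α β : ℝ} (hα : α ≠ 0) (hβ : β ≠ 0) (hαβ : α ≠ β) (a : Fin 3) :
    (α • rayBase) a * ‖β • rayBase‖ ^ 2 - (β • rayBase) a * ‖α • rayBase‖ ^ 2 ≠ 0 := by
  have hb : ‖rayBase‖ ≠ 0 := norm_ne_zero_iff.2 rayBase_ne_zero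
  have e : (α • rayBase) a * ‖β • rayBase‖ ^ 2 - (β • rayBase) a * ‖α • rayBase‖ ^ 2
      = α * β * (β - α) * (rayBase a * ‖rayBase‖ ^ 2) := by
    simp only [PiLp.smul_apply, smul_eq_mul, norm_smul, mul_pow, Real.norm_eq_abs, sq_abs]
    ring
  rw [e]
  exact mul_ne_zero (mul_ne_zero (mul_ne_zero hα hβ) (sub_ne_zero.2 hαβ.symm))
    (mul_ne_zero (rayBase_apply_ne_zero a) (pow_ne_zero 2 hb))

/-! ### Goodness for the coordinate frame -/

/-- A configuration whose three coordinate projections are each injective is good (for the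
coordinate frame `a ↦ e_a`, three linearly independent mirror normals). [folklore] -/
theorem mem_goodConfig_of_apply_injective {n : ℕ} {y : Fin n → EuclideanSpace ℝ (Fin 3)}
    (h : ∀ a : Fin 3, Injective fun i => y i a) : y ∈ GoodConfig n := by
  refine ⟨?_, fun a => EuclideanSpace.single a 1, linearIndependent_single, single_mem_mirrorNormals,
    fun a => ?_⟩
  · rw [mem_nonCoincident]
    intro i j hij
    exact h 0 (congrArg (fun p : EuclideanSpace ℝ (Fin 3) => p 0) hij)
  · have he : (fun i => inner ℝ (y i) (EuclideanSpace.single a (1 : ℝ))) = fun i => y i a := by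
      funext i
      simp [EuclideanSpace.inner_single_right]
    rw [he]
    exact h a

/-- **The perturbed configuration is eventually doubly good.** For a punctured non-coincident `x`,
`x(ε) i = x i + ε • ((i + 1) • p₀)` lies in `InvGoodConfig n` for all sufficiently small `ε > 0`.
[folklore] -/
theorem eventually_perturb_mem_invGoodConfig {n : ℕ} {x : Fin n → EuclideanSpace ℝ (Fin 3)}
    (hx0 : ∀ i, x i ≠ 0) :
    ∀ᶠ ε in 𝓝[>] (0 : ℝ),
      (fun i : Fin n => x i + ε • ((((i : ℕ) : ℝ) + 1) • rayBase)) ∈ InvGoodConfig n := by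
  have hc0 : ∀ i : Fin n, (((i : ℕ) : ℝ) + 1) ≠ 0 := fun i => by positivity
  have hcne : ∀ i j : Fin n, i ≠ j → (((i : ℕ) : ℝ) + 1) ≠ (((j : ℕ) : ℝ) + 1) := by
    intro i j hij h
    exact hij (Fin.ext (by exact_mod_cast (add_right_cancel h : ((i : ℕ) : ℝ) = j)))
  -- (A) all points avoid the pole
  have hA : ∀ᶠ ε in 𝓝[>] (0 : ℝ), ∀ i : Fin n, x i + ε • ((((i : ℕ) : ℝ) + 1) • rayBase) ≠ 0 := by
    refine Filter.eventually_all.2 fun i => eventually_nhdsWithin_of_eventually_nhds ?_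
    have hc : Continuous fun ε : ℝ => x i + ε • ((((i : ℕ) : ℝ) + 1) • rayBase) :=
      continuous_const.add (continuous_id.smul continuous_const)
    exact hc.continuousAt.eventually_ne (by simpa using hx0 i)
  -- (B) coordinates of the perturbed points are pairwise distinct
  have hB : ∀ᶠ ε in 𝓝[>] (0 : ℝ), ∀ (a : Fin 3) (i j : Fin n), i ≠ j →
      (x i + ε • ((((i : ℕ) : ℝ) + 1) • rayBase)) a ≠ (x j + ε • ((((j : ℕ) : ℝ) + 1) • rayBase)) a := by
    simp only [Filter.eventually_all]
    intro a i j hij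
    exact eventually_apply_ne (smul_rayBase_apply_ne (hcne i j hij) a)
  -- (C) cleared-denominator numerators of the inverted coordinates are pairwise non-zero
  have hC : ∀ᶠ ε in 𝓝[>] (0 : ℝ), ∀ (a : Fin 3) (i j : Fin n), i ≠ j →
      (x i + ε • ((((i : ℕ) : ℝ) + 1) • rayBase)) a * ‖x j + ε • ((((j : ℕ) : ℝ) + 1) • rayBase)‖ ^ 2 -
        (x j + ε • ((((j : ℕ) : ℝ) + 1) • rayBase)) a *
          ‖x i + ε • ((((i : ℕ) : ℝ) + 1) • rayBase)‖ ^ 2 ≠ 0 := by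
    simp only [Filter.eventually_all]
    intro a i j hij
    exact eventually_invNumerator_ne_zero (smul_rayBase_coeff_ne_zero (hc0 i) (hc0 j) (hcne i j hij) a)
  filter_upwards [hA, hB, hC] with ε hAε hBε hCε
  refine ⟨hAε, mem_goodConfig_of_apply_injective fun a i j h => ?_,
    mem_goodConfig_of_apply_injective fun a i j h => ?_⟩
  · by_contra hij
    exact hBε a i j hij h
  · by_contra hij
    exact inversion_apply_ne (hAε i) (hAε j) (hCε a i j hij) h

end InvGoodConfigDensity

open InvGoodConfigDensity in
/-- **Stub 3a — density of the doubly-good punctured configurations.** Every punctured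
non-coincident configuration is a limit of doubly-good ones: `x(ε) i = x i + ε (i + 1) p₀ → x` as
`ε → 0⁺` and `x(ε) ∈ InvGoodConfig n` for all small `ε > 0`
(`InvGoodConfigDensity.eventually_perturb_mem_invGoodConfig`). [folklore] -/
theorem stub_invGoodConfig_dense :
    ∀ n, PuncturedNonCoincident n ⊆ closure (InvGoodConfig n) := by
  intro n x hx
  have hc : Continuous fun ε : ℝ => fun i : Fin n => x i + ε • ((((i : ℕ) : ℝ) + 1) • rayBase) :=
    continuous_pi fun i => continuous_const.add (continuous_id.smul continuous_const)
  have ht : Tendsto (fun ε : ℝ => fun i : Fin n => x i + ε • ((((i : ℕ) : ℝ) + 1) • rayBase))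
      (𝓝[>] (0 : ℝ)) (𝓝 x) := by
    refine tendsto_nhdsWithin_of_tendsto_nhds ?_
    have h0 := hc.tendsto 0
    simp only [zero_smul, add_zero] at h0
    exact h0
  exact mem_closure_of_tendsto ht (eventually_perturb_mem_invGoodConfig hx.2)

end Summit.CriticalPhenomena.Ising3DConformalLimit.MoebiusLimitExistsOneMapOneJet
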